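import Summits.BirchSwinnertonDyer.Rank1Residual.O5.O5FlatKummerNormalForm
import Mathlib.NumberTheory.Padics.Hensel
import HarnessLib

/-!
# O5 — T30.6 `FlexNFCaseSKummerLawThree` is FALSE AS TYPED (negative edge): the SIGN NORMALISATION of `A₃` is missing
# (cell `b2b-bsdres`, team n1011, ROW T-FLEX-KOD extension 3; seat `b2b-bsdres-n1011-p18` GEN 14 under the idle rule;
#  theorems only; nothing of the typer's file `O5/O5FlatKummerNormalForm.lean` is edited — the ERRATUM banner, the
#  `@[conjecture]` drop and the repaired node are cc-typer-5's / o5-r1's docket)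

HONEST FRAMING (cell `b2b-bsdres`, run/shared/lean/b2b/bsd-rank1-residual/, verbatim in every file): the
goal of the cell is to DELETE the COMBINATION-SHAPED residual classes of the Birch–Swinnerton-Dyer formula
for ALL analytic-rank `≤ 1` elliptic curves over `ℚ` — "full BSD formula for every rank `≤ 1` curve in
class `C`" assembled STRICTLY from published theorems — so that the rank-`≤ 1` remainder becomes exactly
the CONSTRUCTION-SHAPED classes, which are TYPED (missing-input `Prop`s), NOT attempted. This is not
"finishing BSD". Lane CLASS-CLOSURE / O5 (O5 OPEN): research route; census output (P-K19) is EVIDENCE,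
never a Literature fact; nothing is booked; no mark of `RESIDUAL-MAP.md` moves. This file: THEOREMS ONLY
(no definition, no named fact, no `@[conjecture]` node, no `sorry`; net named-fact debt `0`). An O5-scoped
negative-edge event: it closes NO pair and moves NO mark.

## What is refuted, and why it is a mis-statement (not a substantive failure of T30.6)

o5-r1 GEN 13's T30.6 (`T30-FLAT-KUMMER-NORMAL-FORM.md` §1) is stated for the flex normal form
`y² + 3b·xy + 3ᵃA₃·y = x³` with the UNIT PART OF `A₃` NORMALISED `≡ 1 (mod 3)` (T30.1 (f): the change `u = −1`
maps `(b, A₃) ↦ (−b, −A₃)`).  The typed node `FlexNFCaseSKummerLawThree` (cc-typer-5 A-O5-28) binds only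
`¬ 3 ∣ A₃` and reads the cell from `cellS a b`, i.e. from `b mod 3` alone.  For `a = 1` the `k`-column of
`cellS` is NOT symmetric under `b ↦ −b` (`k = 1` iff `b ≡ 2`, `k = 2` iff `b ≢ 2 (mod 3)`), so on the residue
class `A₃ ≡ 2 (mod 3)` the node asserts the law of the WRONG cell.  WITNESS `(a, b, A₃) = (1, 2, 2)`, the curve
`y² + 6xy + 6y = x³` (normalised: `(b, A₃) = (−2, −2)`, `b ≡ 1 (mod 3)`, true cell `(2, plane)`): `cellS 1 2` says
`k = 1`, so the node claims `NFKummerInLineOfA₃ 2 2 1` — every `y(P)` (`x(P) ≠ 0`) is `6ᵉ · w³`; but the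
`ℚ₃`-point `(ξ, 4)` with `ξ³ − 24ξ − 40 = 0`, `ξ ≡ 7 (mod 9)` (Hensel: `‖F(7)‖ = 3⁻³ < 3⁻² = ‖F′(7)‖²`) has
`y = 4`, a `3`-adic unit with `4² ≢ 1 (mod 9)`, hence NOT of the form `6ᵉ·w³` (valuations force `3 ∣ e`, then `4`
would be a cube; `not_exists_pow_three_eq_of_sq_ne_one`).  REPAIRED STATEMENT `C′` (the planner's text): add the
binder `A₃ % 3 = 1` (as the Case-N nodes `FlexNFCaseNKodairaLawThree` / `FlexNFCaseNKummerLawThree` already do), or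
read the cell at `cellS a (b · χ(A₃))`, `χ(A₃) = ±1 ≡ A₃ (mod 3)`; the witness has `A₃ % 3 = 2` and MISSES `C′`.
T30.5 `FlexNFCaseSKodairaLawThree` (PROVED, p332637) is unaffected: the Kodaira/conductor columns of `cellS` are
`b ↦ −b` symmetric.

[cite: SilvermanATAEC1994, IV.9.4 (Tate's algorithm)] [cite: CohenPazuki2009ThreeDescent, Def. 1.3 and Prop. 2.2 (arXiv:0903.4963 pp. 4–5)]
-/

noncomputable section

open Polynomial

namespace Summit.BirchSwinnertonDyer.Rank1Residual.O5.FlexNormalForm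

/-! ## §1 The Hensel point `(ξ, 4)` on `y² + 6xy + 6y = x³` -/

/-- `‖n‖ = 1` in `ℤ₃` for an integer `n` prime to `3`. [folklore] -/
private theorem norm_intCast_eq_one {n : ℤ} (hn : ¬ (3 : ℤ) ∣ n) : ‖(n : ℤ_[3])‖ = 1 :=
  le_antisymm (PadicInt.norm_le_one _)
    (not_lt.1 fun h ↦ hn (by exact_mod_cast (PadicInt.norm_int_lt_one_iff_dvd n).1 h))

/-- **Hensel.** `x³ − 24x − 40` has a root `ξ ∈ ℤ₃` with `‖ξ − 7‖ < 3⁻¹` (`F(7) = 135 = 3³·5`,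
`F′(7) = 123 = 3·41`). [folklore] -/
theorem exists_root_cubic_witness :
    ∃ ξ : ℤ_[3], ξ ^ 3 - 24 * ξ - 40 = 0 ∧ ‖ξ - 7‖ < (3 : ℝ)⁻¹ := by
  have h3 : ‖(3 : ℤ_[3])‖ = (3 : ℝ)⁻¹ := by exact_mod_cast PadicInt.norm_p (p := 3)
  let G : ℤ_[3][X] := X ^ 3 - C 24 * X - C 40
  have hG : ∀ t : ℤ_[3], aeval t G = t ^ 3 - 24 * t - 40 := fun t ↦ by simp [G]
  have hG' : ∀ t : ℤ_[3], aeval t (derivative G) = 3 * t ^ 2 - 24 := fun t ↦ by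
    simp [G, derivative_mul]
    norm_num
  have h41 : ‖(41 : ℤ_[3])‖ = 1 := by exact_mod_cast norm_intCast_eq_one (n := 41) (by decide)
  have h5 : ‖(5 : ℤ_[3])‖ = 1 := by exact_mod_cast norm_intCast_eq_one (n := 5) (by decide)
  have hn1 : ‖aeval (7 : ℤ_[3]) (derivative G)‖ = (3 : ℝ)⁻¹ := by
    rw [hG', show (3 : ℤ_[3]) * 7 ^ 2 - 24 = 3 * 41 by norm_num, norm_mul, h3, h41, mul_one]
  have hn0 : ‖aeval (7 : ℤ_[3]) G‖ = (3 : ℝ)⁻¹ ^ 3 := by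
    rw [hG, show (7 : ℤ_[3]) ^ 3 - 24 * 7 - 40 = 3 ^ 3 * 5 by norm_num, norm_mul, norm_pow, h3, h5,
      mul_one]
  have hnorm : ‖aeval (7 : ℤ_[3]) G‖ < ‖aeval (7 : ℤ_[3]) (derivative G)‖ ^ 2 := by
    rw [hn0, hn1]; norm_num
  obtain ⟨ξ, hξ, hξ7, -, -⟩ := hensels_lemma hnorm
  refine ⟨ξ, by rw [← hG]; exact hξ, by rw [← hn1]; exact hξ7⟩

/-- The point `(ξ, 4)` lies on `y² + 6xy + 6y = x³` over `ℚ₃` (`OnNF 2 2 1`), with `ξ ≠ 0`. [folklore] -/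
theorem exists_point_four :
    ∃ x : ℚ_[3], OnNF 2 2 1 x 4 ∧ x ≠ 0 := by
  obtain ⟨ξ, hξ, -⟩ := exists_root_cubic_witness
  refine ⟨(ξ : ℚ_[3]), ?_, ?_⟩
  · have h : ((ξ ^ 3 - 24 * ξ - 40 : ℤ_[3]) : ℚ_[3]) = 0 := by rw [hξ]; rfl
    have h24 : ((24 : ℤ_[3]) : ℚ_[3]) = 24 := by exact_mod_cast PadicInt.coe_natCast (p := 3) 24
    have h40 : ((40 : ℤ_[3]) : ℚ_[3]) = 40 := by exact_mod_cast PadicInt.coe_natCast (p := 3) 40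
    push_cast at h
    rw [h24, h40] at h
    simp only [OnNF]
    push_cast
    linear_combination (-1 : ℚ_[3]) * h
  · intro h0
    have hξ0 : ξ = 0 := PadicInt.coe_eq_zero.1 h0
    rw [hξ0] at hξ
    norm_num at hξ

/-! ## §2 `4` is not `6ᵉ · w³` in `ℚ₃` -/

/-- `4` is not a cube in `ℚ₃` (`4² = 16 ≢ 1 (mod 9)`). [folklore] -/
theorem four_not_cube : ¬ ∃ w : ℚ_[3], (4 : ℚ_[3]) = w ^ 3 := by
  have h4 : ‖((4 : ℤ) : ℤ_[3])‖ = 1 := norm_intCast_eq_one (by decide)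
  have hres : (PadicInt.toZModPow 2 ((4 : ℤ) : ℤ_[3])) ^ 2 ≠ 1 := by
    rw [map_intCast]; decide
  have h := ThreeTorsionNormalForm.not_exists_pow_three_eq_of_sq_ne_one h4 hres
  rintro ⟨w, hw⟩
  refine h ⟨w, ?_⟩
  rw [PadicInt.coe_intCast]; exact_mod_cast hw

/-- `4 ≠ 6ᵉ · w³` in `ℚ₃` for every `e : ℕ`, `w : ℚ₃`: valuations force `3 ∣ e`, and then `4` would be a cube.
[folklore] -/
theorem four_ne_six_pow_mul_cube (e : ℕ) (w : ℚ_[3]) :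
    (4 : ℚ_[3]) ≠ ((3 : ℚ_[3]) ^ 1 * (2 : ℚ_[3])) ^ e * w ^ 3 := by
  intro h
  have hw : w ≠ 0 := by
    rintro rfl
    norm_num at h
  -- valuations: `v(4) = 0`, `v(3¹·2) = 1`, so `0 = e + 3 v(w)`
  have hv2 : (2 : ℚ_[3]).valuation = 0 := by
    rw [show (2 : ℚ_[3]) = ((2 : ℤ) : ℚ_[3]) by norm_cast, Padic.valuation_intCast]
    exact_mod_cast padicValInt.eq_zero_of_not_dvd (p := 3) (z := 2) (by decide)
  have hv4 : (4 : ℚ_[3]).valuation = 0 := by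
    rw [show (4 : ℚ_[3]) = ((4 : ℤ) : ℚ_[3]) by norm_cast, Padic.valuation_intCast]
    exact_mod_cast padicValInt.eq_zero_of_not_dvd (p := 3) (z := 4) (by decide)
  have hv3 : (3 : ℚ_[3]).valuation = 1 := by exact_mod_cast Padic.valuation_p (p := 3)
  have hv6 : ((3 : ℚ_[3]) ^ 1 * 2).valuation = 1 := by
    rw [pow_one, Padic.valuation_mul (by norm_num) (by norm_num), hv3, hv2, add_zero]
  have h60 : (3 : ℚ_[3]) ^ 1 * 2 ≠ 0 := by norm_num
  have hval := congrArg Padic.valuation h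
  rw [hv4, Padic.valuation_mul (pow_ne_zero _ h60) (pow_ne_zero _ hw), Padic.valuation_pow,
    Padic.valuation_pow, hv6, mul_one] at hval
  push_cast at hval
  -- so `e = 3 j`
  obtain ⟨j, hj⟩ : 3 ∣ e := by
    have : (3 : ℤ) ∣ (e : ℤ) := ⟨-w.valuation, by linarith⟩
    exact_mod_cast this
  apply four_not_cube
  exact ⟨((3 : ℚ_[3]) ^ 1 * 2) ^ j * w, by rw [h, hj]; ring⟩

/-! ## §3 The refutation -/

/-- **T30.6 `FlexNFCaseSKummerLawThree` is FALSE AS TYPED** (sign-normalisation slip: `cellS` reads `b mod 3`, the law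
is for `A₃`'s unit part `≡ 1 (mod 3)`).  Witness `(a, b, A₃) = (1, 2, 2)`: `cellS 1 2` has `k = 1`, so the node
demands `NFKummerInLineOfA₃ 2 2 1`, refuted by the point `(ξ, 4)` of `y² + 6xy + 6y = x³` (`exists_point_four`,
`four_ne_six_pow_mul_cube`).  REPAIRED `C′`: add `A₃ % 3 = 1`; the witness (`A₃ = 2`) misses `C′`.  O5-scoped
negative edge; closes no pair, moves no mark. [cite: SilvermanATAEC1994, IV.9.4 (Tate's algorithm)] -/
theorem not_flexNFCaseSKummerLawThree : ¬ FlexNFCaseSKummerLawThree := by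
  intro h
  obtain ⟨-, hline, -⟩ := h 1 2 2 (Or.inl rfl) (by decide)
  have hk : (cellS 1 2).k = 1 := by decide
  obtain ⟨x, hx, hx0⟩ := exists_point_four
  obtain ⟨e, w, hw⟩ := hline hk x 4 hx hx0
  exact four_ne_six_pow_mul_cube e w (by exact_mod_cast hw)

end Summit.BirchSwinnertonDyer.Rank1Residual.O5.FlexNormalForm
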